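import Literature.MathematicalPhysics.QuantumFieldTheory.Balaban1983to89.B8Prop6CubeMemberFlatScalar

/-!
# `Balaban1983to89.B8Prop6CubeMemberFlatScalarPrinted` — [Balaban1985RegularSpaces] PROPOSITION 6 (p. 99) AT THE CONCRETE CUBE MEMBER WITH EXACTLY
# PRINT'S HYPOTHESES («7dL²Mα₀ ≤ c₁», `L ≤ dM`) AND PRINT'S CONSTANT `7dL²B₁Mα₀`, MODULO THREE FAMILIES OF REAL INEQUALITIES ON THE EXPLICIT MATRICES OF
# THE FLAT [4]-LETTERS AND (1.59) FOR `G(1)` — g2's `B8Prop6CubeMemberFlat3.prop6_asPrinted_cubeMember_at₃` with its Proposition-5 bodies discharged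

statement-level skeleton of published theorems with citation tags; proofs where landed; nothing here is a claim about the
Yang–Mills mass gap

`[Balaban1985RegularSpaces]` ("B8", CMP **99** (1985) 75–102) Sect. F pp. 98–99 (Prop. 6, (1.131)–(1.138), (1.134)), Thm 4 p. 88, Prop. 5 pp. 93–94,
(1.92) p. 91, (1.98) p. 92, (1.101) p. 93, (1.59) p. 86; [4] = `[Balaban1985BackgroundPropagators]` Thms 3.1–3.3 pp. 397–398.
PDF held: `paper:balaban1985-cmp99-regular-spaces-gauge-fixing` (journal page = PDF page + 74).

CITATION HEADER (lean-in-tree rule).  Cell `pub-ymgap` (YM Track A, HUMAN RULING D-0062), DAG node N05 = [B8], seat `pub-ymgap-dag-n05-e` (g4; director-ym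
R141 (C), FAN-OUT §N05 row s3b — THE FLAT CURRENCY for Proposition 6).  Companion of `B8Prop6CubeMemberFlatScalar` (filed separately for the 400-line
rule): ★ `prop6_asPrinted_cubeMember_flat_of_real` = g2's `prop6_asPrinted_cubeMember_at₃` (print's hypotheses: the (1.130)-regime absorbed into the threshold,
«let 7dL²Mα₀ ≤ c₁» + the implicit `L ≤ dM`; print's constant `Lʲη|A| ≤ 7dL²B₁Mα₀`, `B₁ = 5dLB₀`) with its two Proposition-5 bodies `P5base₁`∕`P5step₁`
DISCHARGED from nonnegative weights `w` and the three REAL inequality families on the explicit matrices `T⁻¹`, `T⁻¹(T⁻¹Qᵀ)(QT⁻¹T⁻¹Qᵀ)⁻¹`,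
`T⁻¹Qᵀ(QT⁻¹T⁻¹Qᵀ)⁻¹QT⁻¹` of the flat [4]-letters on `□₀` at every truncation ([4] Thms 3.1–3.2 at `U = 1`, Dirichlet, real lattice functions); kept:
`H59₁`.  Proof = g2's verbatim with `B8Prop6CubeMemberFlatScalar.prop6_cubeMember_flat_of_real` for `prop6_exists_cubeMember_at₃`.

HONEST SCOPE.  Composition by name; nothing of [4] is proved (displayed hypotheses); the standing relation `3·2dL²·B_G·B_R ≤ B₀′` is displayed; everything
else as in `B8Prop6CubeMemberFlat3` ∕ `B8Prop6CubeMember` (HONEST SCOPE there: (1.136) = the `|A|` member only at this layer, non-strict `≤`, `B₁ = 5dLB₀`).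
Count-neutral; N05 NOT discharged; one finite `T⁴` programme at fixed `ε`, Bałaban as printed; nothing continuum ∕ ℝ⁴ ∕ OS ∕ mass-gap ∕ Clay.  No `sorry`,
no `def`, no `instance`, no `notation`.  Unit `pub-ymgap-dag-n05-e` (g4), 2026-08-27.
-/

noncomputable section

namespace Literature.MathematicalPhysics.QuantumFieldTheory.Balaban1983to89.B8Prop6CubeMemberFlatScalarPrinted

open scoped Matrix
open B7Prop1Explicit B7Prop2Explicit B7Prop1Local B7Eq92Concrete B8Ineq130
open B7Prop2Explicit (C0 c2')
open B7Eq78Linearization (QprimeIter zdBlocking)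
open B8Ineq132 (covDerivFwd InAk pdevOn_lt_of_inAk)
open B8Ineq133 (cutFixed)
open B8Eq115GaugeFixing (localGauge)
open B8Eq119TwistedAxial (InAx Restr129 bgT)
open B8Eq184Proof (gaugeExp cfgExp)
open B8Lemma1NonAbelian (mulCfg)
open B8Eq140Level (SideTouches)
open B8Eq146AExpansion (iEta)
open B7Prop4GeneralLevels (linCovIter)
open B8Eq155JBound (Jcur wsup)
open B8ScaledSupNorm (bondNorm msup)
open B8Thm2LogB (blockTop)
open B8Eq138LandauZd (IsLandau138W logCfg covLap QT)
open B8Eq1117Concrete (XSpace)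
open B8Prop5ContractionKLevel (Bd2)
open B8LambdaSpaceKLevel (wt)
open B8Eq131Cubes (tcube tLo tHi ctr tLo_le_tHi)
open B8Eq131CubesAdmissible (cubeFam)
open B8Prop6OfThm4 (localGauge_mem agree135 smallness_134 const_136)
open B8CubeMemberZd (cubeLamS cubeLamB)
open B8Prop6CubeMember (thm4_hypotheses_one_cutFixed regime_of_printed_smallness)
open B8Prop6CubeMemberFlatScalar (prop6_cubeMember_flat_of_real)
open Literature.MathematicalPhysics.QuantumLattice (blockMap)

export B7Prop1Explicit (Site)

variable {d : ℕ}

variable {𝔸 : Type} [CStarAlgebra 𝔸] [Nontrivial 𝔸]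

open Classical in
/-- ★ **PROPOSITION 6 (p. 99) AT THE CONCRETE CUBE MEMBER WITH EXACTLY PRINT'S HYPOTHESES, MODULO THREE REAL INEQUALITY FAMILIES ON THE EXPLICIT MATRICES AND
(1.59) FOR `G(1)`** — g2's `B8Prop6CubeMemberFlat3.prop6_asPrinted_cubeMember_at₃` (print: «U₀, U₀′, □, □̃ as described, let 7dL²Mα₀ ≤ c₁» + the implicit
`L ≤ dM`; conclusion ∃ unitary `u` (= 1 off `□₀`, (1.29)) with `U₀^{w⁻¹} = U₀″^{u⁻¹} = e^{iηA}` on `□̃` ((1.135)), `A` Hermitian, `Lʲη|A| ≤ 7dL²B₁Mα₀` ((1.136)₁,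
`B₁ = 5dLB₀`), (1.38) of record) with the two Proposition-5 bodies at the flat datum DISCHARGED: hypotheses = nonnegative weights `w`, the three REAL families
on the explicit matrices of the flat [4]-letters on `□₀` at every truncation ((1.101), (1.92) + p. 93 `Δ`-entry, (1.98), real lattice functions), `H59₁`;
ONE threshold `c₁(d, L, B₀, B₀′, B′₀, B₂′, B_G, B_R) > 0` with the standing relation `3·2dL²·B_G·B_R ≤ B₀′`.  Proof = g2's with
`prop6_cubeMember_flat_of_real` for `prop6_exists_cubeMember_at₃`.
[cite: Balaban1985RegularSpaces, Prop. 6 (1.135)–(1.138) p.99, p.98, (1.134) p.99, Thm 4 p.88 (existence), (1.92) p.91, (1.98) p.92, (1.101) p.93, (1.59) p.86; Balaban1985BackgroundPropagators, Thms 3.1–3.3 pp.397–398] -/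
theorem prop6_asPrinted_cubeMember_flat_of_real (hd2 : 2 ≤ d) {L : ℕ} (hL : 2 ≤ L) {B₀ B₀' B₀'H B₂' BG BR : ℝ} (hB₀ : 0 < B₀)
    (hB₀' : 0 < B₀') (hB : 2 ≤ 5 * (d : ℝ) * L * B₀) (hB₀'H : 0 < B₀'H) (hB₂' : 0 ≤ B₂') (hBG : 0 ≤ BG) (hBR : 0 ≤ BR)
    (hfree : 3 * (2 * (d : ℝ) * (L : ℝ) ^ 2) * BG * BR ≤ B₀') :
    ∃ c₁ : ℝ, 0 < c₁ ∧ ∀ (η : ℝ), 0 < η → ∀ (k : ℕ), 1 ≤ k → ∀ (a : Site d) (M ρ : ℕ), L ≤ ρ → ρ ≤ M → 11 * (d : ℝ) < M →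
      (L : ℝ) ≤ d * M →
      ∀ (U₀ : Site d → Fin d → 𝔸ˣ), (∀ x κ, U₀ x κ ∈ unitaryUnits 𝔸) → ∀ (α₀ : ℝ), 0 < α₀ →
      ∀ (Ω : ℕ → Set (Site d)), InAk L k η α₀ Ω U₀ → tcube L a M ρ k ⊆ Ω (k - 1) →
      7 * d * (L : ℝ) ^ 2 * M * α₀ ≤ c₁ →
      -- the weights of `Q′ᵀaQ′` (free, nonnegative) and THE THREE REAL INEQUALITY FAMILIES at every truncation `n ≤ k` on the explicit matrices
      ∀ (w : ℕ → ℝ), (∀ j, 0 ≤ w j) →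
      (∀ n, 1 ≤ n → n ≤ k → ∀ (S : Finset (Site d)), (∀ x, x ∈ S ↔ x ∈ cubeFam false L a M ρ k 0) →
        ∀ (B : Finset (ℕ × Site d)), (∀ p, p ∈ B ↔ p.1 ≤ n ∧ p.2 ∈ cubeLamS L a M ρ k n p.1) →
        ∀ (K : Site d → Site d → ℝ), (∀ x z, K x z =
          ((η ^ 2)⁻¹ * ∑ μ : Fin d, ((2 : ℝ) * (if z = x then (1 : ℝ) else 0) - (if z = x + e μ then (1 : ℝ) else 0)
            - (if z = x - e μ then (1 : ℝ) else 0))) +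
          (∑ j ∈ Finset.range (n + 1), (if blockMap (L ^ j) x ∈ cubeLamS L a M ρ k n j ∧ blockMap (L ^ j) z = blockMap (L ^ j) x then
            w j * ((((L : ℝ) ^ d)⁻¹) ^ j) ^ 2 else 0))) →
        ∀ (T : Matrix ↥S ↥S ℝ), T = Matrix.of (fun x z : ↥S => K x.1 z.1) →
        ∀ (Q : Matrix ↥B ↥S ℝ), Q = Matrix.of (fun (p : ↥B) (z : ↥S) =>
          if blockMap (L ^ p.1.1) z.1 = p.1.2 then (((L : ℝ) ^ d)⁻¹) ^ p.1.1 else 0) →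
        -- (1.101) for `T⁻¹`, real lattice functions
        (∀ (ρ' : ↥S → ℝ) (r : ℝ), 0 ≤ r →
          (∀ j, j ≤ n → ∀ z : ↥S, z.1 ∈ cubeFam false L a M ρ k j → wt L η j ^ 2 * |ρ' z| ≤ r) →
          ∀ φ : Site d → ℝ, (∀ x, x ∉ cubeFam false L a M ρ k 0 → φ x = 0) → (∀ v : ↥S, φ v.1 = ∑ z : ↥S, T⁻¹ v z * ρ' z) →
          (∀ x, |φ x| ≤ BG * r) ∧
          ∀ j, j ≤ n → ∀ p ∈ {b : Site d × Fin d | SideTouches (cubeFam false L a M ρ k j) b.1 b.2},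
            wt L η j * |η⁻¹ * (φ (p.1 + e p.2) - φ p.1)| ≤ BG * r) ∧
        -- (1.92) and the p. 93 `Δ`-entry for `T⁻¹(T⁻¹Qᵀ)(QT⁻¹T⁻¹Qᵀ)⁻¹`, real `X`
        (∀ (X : ↥B → ℝ) (s : ℝ), 0 ≤ s → (∀ p', |X p'| ≤ s) →
          ∀ φ : Site d → ℝ, (∀ x, x ∉ cubeFam false L a M ρ k 0 → φ x = 0) →
          (∀ v : ↥S, φ v.1 = ∑ p' : ↥B, (T⁻¹ * (T⁻¹ * Qᵀ) * (Q * T⁻¹ * T⁻¹ * Qᵀ)⁻¹) v p' * X p') →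
          (∀ x, |φ x| ≤ B₀'H * s) ∧
          (∀ j, j ≤ n → ∀ p ∈ {b : Site d × Fin d | SideTouches (cubeFam false L a M ρ k j) b.1 b.2},
            wt L η j * |η⁻¹ * (φ (p.1 + e p.2) - φ p.1)| ≤ B₀'H * s) ∧
          (∀ j, j ≤ n → ∀ x ∈ cubeFam false L a M ρ k j,
            wt L η j ^ 2 * |∑ μ : Fin d, (η ^ 2)⁻¹ * (2 * φ x - φ (x + e μ) - φ (x - e μ))| ≤ B₂' * s)) ∧
        -- (1.98) for `1 − T⁻¹Qᵀ(QT⁻¹T⁻¹Qᵀ)⁻¹QT⁻¹`, real lattice functions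
        (∀ (ρ' : ↥S → ℝ) (r : ℝ), 0 ≤ r →
          (∀ j, j ≤ n → ∀ z : ↥S, z.1 ∈ cubeFam false L a M ρ k j → wt L η j ^ 2 * |ρ' z| ≤ r) →
          ∀ j, j ≤ n → ∀ v : ↥S, v.1 ∈ cubeFam false L a M ρ k j →
            wt L η j ^ 2 * |ρ' v - ∑ z : ↥S, (T⁻¹ * (Qᵀ * ((Q * T⁻¹ * T⁻¹ * Qᵀ)⁻¹ * (Q * T⁻¹)))) v z * ρ' z| ≤ BR * r)) →
      ((∀ m, 1 ≤ m → m ≤ k → ∀ (u : Site d → 𝔸ˣ) (W : Site d → Fin d → 𝔸ˣ) (A' : Site d → Fin d → 𝔸),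
        (∀ x, u x ∈ unitaryUnits 𝔸) → mgauge (1 : Site d → Fin d → 𝔸ˣ) u W = (cutFixed L (tLo a ρ) (tHi a M ρ) U₀ k (ctr a M)) →
          Restr129 L m ((cubeLamS L a M ρ k) m) (1 : Site d → Fin d → 𝔸ˣ) u →
          IsLandau138W L m η ((cubeFam false L a M ρ k) 0) ((cubeLamS L a M ρ k) m) (1 : Site d → Fin d → 𝔸ˣ) W →
        (∀ y τ, IsSelfAdjoint (A' y τ)) →
        (∀ j, j ≤ m → ∀ y τ, SideTouches ((cubeFam false L a M ρ k) j) y τ →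
        W y τ = cfgExp η A' y τ ∧
          ‖A' y τ‖ ≤ (2 * (L * (5 * (d : ℝ) * L * B₀ * (((L : ℝ) ^ 3 * α₀) + (6 * d * (L : ℝ) ^ 2 * M * α₀)))) + 8 * (8 * B₀' * (5 * (d : ℝ) * L * B₀) * (((L : ℝ) ^ 3 * α₀) + (6 * d * (L : ℝ) ^ 2 * M * α₀)))) * ((L : ℝ) ^ j * η)⁻¹) →
        (∀ y τ, (∀ j, j ≤ m → ¬ SideTouches ((cubeFam false L a M ρ k) j) y τ) → A' y τ = 0) →
        msup L m η (-(1 : ℝ)) (fun j (b : Site d × Fin d) => SideTouches ((cubeFam false L a M ρ k) j) b.1 b.2) (fun b => A' b.1 b.2)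
        ≤ B₀ * (bondNorm L m η (-(3 : ℝ)) (cubeFam false L a M ρ k) (fun x μ => Jcur η (1 : Site d → Fin d → 𝔸ˣ) A' μ x)
        + wsup 1 (fun p : {p : ℕ × (Site d × Fin d) // p.1 ≤ m ∧ p.2 ∈ (cubeLamB L a M ρ k) m p.1} =>
        linCovIter L (1 : Site d → Fin d → 𝔸ˣ) (iEta η A') p.1.1 p.1.2.1 p.1.2.2)) ∧
        msup L m η (-(2 : ℝ)) (fun j (t : Fin d × Fin d × Site d) => SideTouches ((cubeFam false L a M ρ k) j) t.2.2 t.2.1)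
        (fun t => covDerivFwd η (1 : Site d → Fin d → 𝔸ˣ) t.1 (fun z => A' z t.2.1) t.2.2)
        ≤ B₀ * (bondNorm L m η (-(3 : ℝ)) (cubeFam false L a M ρ k) (fun x μ => Jcur η (1 : Site d → Fin d → 𝔸ˣ) A' μ x)
        + wsup 1 (fun p : {p : ℕ × (Site d × Fin d) // p.1 ≤ m ∧ p.2 ∈ (cubeLamB L a M ρ k) m p.1} =>
        linCovIter L (1 : Site d → Fin d → 𝔸ˣ) (iEta η A') p.1.1 p.1.2.1 p.1.2.2)))) →
      ∃ u : Site d → 𝔸ˣ, (∀ x, u x ∈ unitaryUnits 𝔸) ∧ (∀ x, x ∉ cubeFam false L a M ρ k 0 → u x = 1) ∧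
        Restr129 L k (cubeLamS L a M ρ k k) (1 : Site d → Fin d → 𝔸ˣ) u ∧
        IsLandau138W L k η (cubeFam false L a M ρ k 0) (cubeLamS L a M ρ k k) (1 : Site d → Fin d → 𝔸ˣ)
          (gaugeAct u⁻¹ (cutFixed L (tLo a ρ) (tHi a M ρ) U₀ k (ctr a M))) ∧
        (∀ j, j ≤ k → ∀ b ∈ {b : Site d × Fin d | SideTouches (cubeFam false L a M ρ k j) b.1 b.2},
          gaugeAct u⁻¹ (cutFixed L (tLo a ρ) (tHi a M ρ) U₀ k (ctr a M)) b.1 b.2 =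
              cfgExp η (logCfg η (gaugeAct u⁻¹ (cutFixed L (tLo a ρ) (tHi a M ρ) U₀ k (ctr a M)))) b.1 b.2 ∧
            IsSelfAdjoint (logCfg η (gaugeAct u⁻¹ (cutFixed L (tLo a ρ) (tHi a M ρ) U₀ k (ctr a M))) b.1 b.2) ∧
            ‖logCfg η (gaugeAct u⁻¹ (cutFixed L (tLo a ρ) (tHi a M ρ) U₀ k (ctr a M))) b.1 b.2‖ ≤
              (7 * d * (L : ℝ) ^ 2 * (5 * (d : ℝ) * L * B₀) * M * α₀) * ((L : ℝ) ^ j * η)⁻¹) ∧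
        (∀ x, ((localGauge L (tLo a ρ) (tHi a M ρ) U₀ k (ctr a M))⁻¹ * u) x ∈ unitaryUnits 𝔸) ∧
        AgreeOn (tlo L (tLo a ρ) k) (thi L (tHi a M ρ) k)
          (gaugeAct ((localGauge L (tLo a ρ) (tHi a M ρ) U₀ k (ctr a M))⁻¹ * u)⁻¹ U₀)
          (gaugeAct u⁻¹ (cutFixed L (tLo a ρ) (tHi a M ρ) U₀ k (ctr a M))) := by
  have hL1 : 1 ≤ L := le_trans (by norm_num) hL
  have hd1 : 1 ≤ d := le_trans (by norm_num) hd2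
  have hLpos : (0 : ℝ) < L := by exact_mod_cast lt_of_lt_of_le (by norm_num) hL
  have hC0 := C0_pos d
  have hc2 := c2'_pos d L hL1
  obtain ⟨c₀, hc₀, H⟩ := prop6_cubeMember_flat_of_real (𝔸 := 𝔸) hd2 hL hB₀ hB₀' hB hB₀'H hB₂' hBG hBR hfree
  refine ⟨min c₀ (min (7 / (3 * C0 d)) (min (7 * c2' d L / 2) (7 / 36))), ?_, ?_⟩
  · exact lt_min hc₀ (lt_min (by positivity) (lt_min (by positivity) (by norm_num)))
  intro η hη k hk a M ρ hρL hρM hM hLdM U₀ hU₀ α₀ hα Ω hA hT hc w hw REAL H59₁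
  have hρ : 1 ≤ ρ := hL1.trans hρL
  have hM1 : 1 ≤ M := hρ.trans hρM
  have hc' : 7 * d * (L : ℝ) ^ 2 * M * α₀ ≤ c₀ := hc.trans (min_le_left _ _)
  have hcA : 7 * d * (L : ℝ) ^ 2 * M * α₀ ≤ min (7 / (3 * C0 d)) (min (7 * c2' d L / 2) (7 / 36)) := hc.trans (min_le_right _ _)
  obtain ⟨hα3, hα2, hsmall⟩ := regime_of_printed_smallness (L := L) hd1 hM1 hρM hM hα hcA (min_le_left _ _)
    ((min_le_right _ _).trans (min_le_left _ _)) ((min_le_right _ _).trans (min_le_right _ _))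
  have hB₁ : 0 ≤ 5 * (d : ℝ) * L * B₀ := by positivity
  obtain ⟨u, hu, huS, h129, hLan, h162, hw, h135⟩ := H η hη k hk a M ρ hρL hρM hM U₀ hU₀ α₀ hα hα3 hα2 Ω hA hT hsmall
    (smallness_134 hLpos hα hLdM hc') w hw REAL H59₁
  refine ⟨u, hu, huS, h129, hLan, fun j hj b hb => ?_, hw, h135⟩
  obtain ⟨h1, h2, h3⟩ := h162 j hj b hb
  refine ⟨h1, h2, h3.trans ?_⟩
  have hη0 : 0 ≤ ((L : ℝ) ^ j * η)⁻¹ := by positivity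
  exact mul_le_mul_of_nonneg_right (const_136 hLpos hα hB₁ hLdM) hη0

#print axioms prop6_asPrinted_cubeMember_flat_of_real

end Literature.MathematicalPhysics.QuantumFieldTheory.Balaban1983to89.B8Prop6CubeMemberFlatScalarPrinted

end
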